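import Literature.AnabelianGeometry.SemiGraphs.LevelEdgesOfObject

/-!
# Level edges of `𝒢_X`: branch-group images as stabilisers, and their `V`-conjugacy classes ([SemiAnbd] §2, Rem. 2.2.1)

Mochizuki, *Semi-graphs of anabelioids*, Publ. RIMS **42** (2006), §2, Remark 2.2.1 p. 24: for the
finite étale covering `𝒢′ → 𝒢` attached to `X ∈ B(𝒢)`, the images of the `Π_{v′}`, `Π_{b′}` in `Π_𝒢` are
the stabilisers ("decomposition groups") of the corresponding components [cite: MochizukiSemiAnbd2006, Rem. 2.2.1 p.24].

Proof-only bookkeeping (cell abc-iut, layer L3, row F-1477 / [SemiAnbd] Rmk. 2.10.1, sub-node (L4)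
"level edges", part C = the group-theoretic half of (L4b), seat abc-iut-L6-t18; holder/assembler
abc-iut-L3-t12; dictionary half abc-iut-w5-d186), in the frame of `LevelEdgesOfObject.lean`
(`X, F, b, h, Fe, α`; `y x := F_e(ψ_b)(α⁻¹ x)`; `Π_𝒢 := Aut(ρ_v ⋙ F)`, `Π_b := Π_b^{F_e,α}.map (Π_v → Π_𝒢)`):

* `map_map_stabilizer_eq` — the image in `Π_𝒢` of the stabiliser `Stab_{Π_e}(y x)` (the decomposition
  group, inside `Π_e`, of the level edge through `x`) is `Π_b ⊓ Stab_{Π_𝒢}(x)`;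
* `map_piVToPi_stabilizer_inf` — `Π_v → Π_𝒢` carries `Stab_{Π_v}(p) ⊓ H` onto `Stab_{Π_𝒢}(p) ⊓ H`
  (no injectivity of `Π_v → Π_𝒢` needed);
* `exists_mem_inf_conj_eq` — for an object all of whose points have stabiliser `V` (the Galois object
  `A_V`): if the level edges through `γ′⁻¹ · x₀` and `g⁻¹ · x₀` coincide then
  `V ⊓ γ′Π_bγ′⁻¹ = s (V ⊓ gΠ_bg⁻¹) s⁻¹` for some `s ∈ V` — the level-edge group `V ⊓ gΠ_bg⁻¹` of the
  edge through `g⁻¹ · x₀` is well defined up to `V`-conjugacy (and NOT the group `V ⊓ g⁻¹Π_bg` —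
  cf. the `g⁻¹` in abc-iut's (D2) `covering_vertexFibre_doubleCosets`);
* `eComp_eq_iff_mem_mul_of_inv` — the level edges through `g⁻¹ · x₀` and `x₀` coincide iff
  `g ∈ V · Π_b` (the conclusion of abc-iut-L3-t12's `LevelEdgeSeparation`, verbatim);
* `map_piVToPi_branchSubgroup_refl` — in the frame `F := b^* ⋙ F_e`, `α := refl` of
  `LevelEdgeSeparation`, `Π_b` is literally the range of `Π_b → Π_𝒢`.
* (v2, appended) `levelEdge_ne_of_not_mem_mul`, `le_of_levelEdgeGroups` — the GROUP-THEORETIC CORE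
  of the level-wise edge separation ([SemiAnbd] Rmk. 2.10.1 via the proof of Cor. 2.7 (i), p. 30):
  `g ∉ V · Π_b` makes the level edges through `x₀` and `g⁻¹ · x₀` distinct, and for level-edge groups
  of the dictionary shape `T₁ = V ⊓ γ₁Π_bγ₁⁻¹`, `T_g = V ⊓ γΠ_bγ⁻¹` with `T_g ≤ U` (`U` normalised by
  `V`) the hypothesis `V ⊓ Π_b ≤ gΠ_bg⁻¹` of `LevelEdgeSeparation` forces `T₁ ≤ U`.

No statement here takes a side on any disputed claim; nothing about [IUTchIII] Cor. 3.12.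
-/

namespace Literature.AnabelianGeometry.SemiGraphs

open CategoryTheory CategoryTheory.PreGaloisCategory
open Literature.AnabelianGeometry.Anabelioids
open scoped Pointwise

universe v₁ u₁ u

namespace SemiGraphOfAnabelioids

variable {𝒢 : SemiGraphOfAnabelioids.{v₁, u₁, u}} (X : 𝒢.BObj) {v : 𝒢.graph.Vertex}
  (F : 𝒢.V v ⥤ FintypeCat.{v₁}) [FiberFunctor F] (b : 𝒢.graph.Branch) (h : 𝒢.graph.abuts b = some v)
  (Fe : 𝒢.E (𝒢.graph.edgeOf b) ⥤ FintypeCat.{v₁}) [FiberFunctor Fe]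
  (α : (𝒢.pull b v h).pullback ⋙ Fe ≅ F)

/-! ### Stabilisers through `Π_v → Π_𝒢` -/

omit [FiberFunctor F] [FiberFunctor Fe] in
/-- **`Π_v → Π_𝒢` carries `Stab_{Π_v}(p) ⊓ H` onto `Stab_{Π_𝒢}(p) ⊓ H`** for every point `p ∈ F(S_v)`
of the fibre of `X` and every `H ⊆ Π_v`: an element of `Π_v` fixes `p` iff its image does (the action
of `Π_𝒢 = Aut(ρ_v ⋙ F)` on `(ρ_v ⋙ F)(X) = F(S_v)` restricts to that of `Π_v = Aut F`); no injectivity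
of `Π_v → Π_𝒢` is needed. [cite: MochizukiSemiAnbd2006, Rem. 2.2.1 p.24] -/
theorem map_piVToPi_stabilizer_inf (p : (𝒢.ρ v ⋙ F).obj X) (H : Subgroup (𝒢.PiV v F)) :
    (MulAction.stabilizer (𝒢.PiV v F) (show F.obj (X.S v) from p) ⊓ H).map (𝒢.piVToPi v F) =
      MulAction.stabilizer (𝒢.Pi v F) p ⊓ H.map (𝒢.piVToPi v F) := by
  ext g
  constructor
  · intro hg
    obtain ⟨u, hu, rfl⟩ := Subgroup.mem_map.mp hg
    obtain ⟨hu, huH⟩ := Subgroup.mem_inf.mp hu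
    refine Subgroup.mem_inf.mpr ⟨?_, Subgroup.mem_map_of_mem _ huH⟩
    rw [MulAction.mem_stabilizer_iff, piVToPi_smul]
    have hu' := MulAction.mem_stabilizer_iff.mp hu
    exact hu'
  · intro hg
    obtain ⟨hg, hg'⟩ := Subgroup.mem_inf.mp hg
    obtain ⟨u, huH, rfl⟩ := Subgroup.mem_map.mp hg'
    refine Subgroup.mem_map_of_mem _ (Subgroup.mem_inf.mpr ⟨?_, huH⟩)
    rw [MulAction.mem_stabilizer_iff] at hg ⊢
    rw [piVToPi_smul] at hg
    exact hg

omit [FiberFunctor F] [FiberFunctor Fe] in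
/-- **The decomposition group of a level edge, pushed into `Π_𝒢`.**  For `x ∈ F(S_v)`: the image in
`Π_𝒢` (along `Π_e → Π_b^{F_e,α} ⊆ Π_v → Π_𝒢`) of the stabiliser `Stab_{Π_e}(y x)` of the point
`y x = F_e(ψ_b)(α⁻¹ x) ∈ F_e(T_e)` is `Π_b ⊓ Stab_{Π_𝒢}(x)` ("the image of `Π_{b′}` is the
stabiliser", Remark 2.2.1, at the level of the edge `b′` of `𝒢_X` through `x`).
[cite: MochizukiSemiAnbd2006, Rem. 2.2.1 p.24] -/
theorem map_map_stabilizer_eq (x : (𝒢.ρ v ⋙ F).obj X) :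
    ((MulAction.stabilizer (𝒢.PiB b Fe) (Fe.map (X.ψ b v h).hom (α.inv.app (X.S v) x))).map
        ((Aut.autMulEquivOfIso α).toMonoidHom.comp (𝒢.piBToPiV b v h Fe))).map (𝒢.piVToPi v F) =
      (𝒢.branchSubgroup F b h Fe α).map (𝒢.piVToPi v F) ⊓ MulAction.stabilizer (𝒢.Pi v F) x := by
  -- `Stab_{Π_e}(F_e(ψ_b) z) = Stab_{Π_e}(z)` (`F_e(ψ_b)` is `Π_e`-equivariant and injective)
  have h1 : MulAction.stabilizer (𝒢.PiB b Fe) (Fe.map (X.ψ b v h).hom (α.inv.app (X.S v) x)) =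
      MulAction.stabilizer (𝒢.PiB b Fe)
        (show Fe.obj ((𝒢.pull b v h).pullback.obj (X.S v)) from α.inv.app (X.S v) x) := by
    ext σ
    rw [MulAction.mem_stabilizer_iff, MulAction.mem_stabilizer_iff, mulAction_naturality]
    exact ((Fe ⋙ FintypeCat.incl).mapIso (X.ψ b v h)).toEquiv.injective.eq_iff
  -- `Stab_{Π_e}(α⁻¹ x) = (Stab_{Π_v}(x)).comap (Π_e → Π_b^{F_e,α})`
  have h2 : MulAction.stabilizer (𝒢.PiB b Fe)
        (show Fe.obj ((𝒢.pull b v h).pullback.obj (X.S v)) from α.inv.app (X.S v) x) =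
      (MulAction.stabilizer (𝒢.PiV v F) (show F.obj (X.S v) from x)).comap
        ((Aut.autMulEquivOfIso α).toMonoidHom.comp (𝒢.piBToPiV b v h Fe)) := by
    rw [stabilizer_pullback_eq_comap F b h Fe α (X.S v) (α.inv.app (X.S v) x)]
    have h3 : α.hom.app (X.S v) (α.inv.app (X.S v) x) = x := by
      rw [← FintypeCat.comp_apply (α.inv.app _) (α.hom.app _), ← NatTrans.comp_app, α.inv_hom_id,
        NatTrans.id_app, FintypeCat.id_apply]
    rw [h3]
  rw [h1, h2, Subgroup.map_comap_eq, inf_comm, map_piVToPi_stabilizer_inf, inf_comm]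
  rfl

/-! ### The `V`-conjugacy class of a level-edge group -/

omit [FiberFunctor F] in
/-- **Level-edge groups are well defined up to `V`-conjugacy.**  Let every point of the fibre of `X`
have stabiliser `V` (the Galois object `A_V`).  If the level edges through `γ′⁻¹ · x₀` and through
`g⁻¹ · x₀` coincide (`Q ∋ y(γ′⁻¹ · x₀)`, `Q ∋ y(g⁻¹ · x₀)`), then
`V ⊓ γ′ Π_b γ′⁻¹ = s (V ⊓ g Π_b g⁻¹) s⁻¹` for some `s ∈ V`.  (With `γ′⁻¹ = p g⁻¹ u`, `p ∈ Π_b`,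
`u ∈ V`: `s = u⁻¹`.) [cite: MochizukiSemiAnbd2006, Rem. 2.2.1 p.24] -/
theorem exists_mem_inf_conj_eq {V : Subgroup (𝒢.Pi v F)}
    (hV : ∀ x : (𝒢.ρ v ⋙ F).obj X, MulAction.stabilizer (𝒢.Pi v F) x = V) {x₀ : (𝒢.ρ v ⋙ F).obj X}
    (γ' g : 𝒢.Pi v F) {Q : π₀Obj (X.T (𝒢.graph.edgeOf b))}
    (hQγ : Fe.map (X.ψ b v h).hom (α.inv.app (X.S v) (γ'⁻¹ • x₀)) ∈ Set.range (Fe.map Q.1.arrow))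
    (hQg : Fe.map (X.ψ b v h).hom (α.inv.app (X.S v) (g⁻¹ • x₀)) ∈ Set.range (Fe.map Q.1.arrow)) :
    ∃ s ∈ V, V ⊓ ConjAct.toConjAct γ' • (𝒢.branchSubgroup F b h Fe α).map (𝒢.piVToPi v F) =
      ConjAct.toConjAct s • (V ⊓ ConjAct.toConjAct g • (𝒢.branchSubgroup F b h Fe α).map
        (𝒢.piVToPi v F)) := by
  set Pb := (𝒢.branchSubgroup F b h Fe α).map (𝒢.piVToPi v F) with hPb
  -- the stabiliser of a point all of whose translates have the same stabiliser is normal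
  haveI : V.Normal := ⟨fun n hn c => by
    rw [← hV x₀, MulAction.mem_stabilizer_iff, mul_smul, mul_smul]
    have hn' : n • c⁻¹ • x₀ = c⁻¹ • x₀ := by
      rw [← MulAction.mem_stabilizer_iff, hV]
      exact hn
    rw [hn', smul_inv_smul]⟩
  -- `γ'⁻¹ x₀ = p • g⁻¹ x₀` for some `p ∈ Π_b`
  have hmem := (eComp_eq_iff_mem_orbit_branchSubgroup X F b h Fe α hQg hQγ).mp rfl
  obtain ⟨⟨p, hp⟩, hpx⟩ := MulAction.mem_orbit_iff.mp hmem
  -- `u := g p⁻¹ γ'⁻¹ ∈ V`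
  set u : 𝒢.Pi v F := g * (𝒢.piVToPi v F p)⁻¹ * γ'⁻¹ with hu
  have huV : u ∈ V := by
    rw [← hV x₀, MulAction.mem_stabilizer_iff, hu, mul_smul, mul_smul]
    have hpx' : (𝒢.piVToPi v F p) • (g⁻¹ • x₀) = γ'⁻¹ • x₀ := by
      rw [piVToPi_smul]; exact hpx
    rw [← hpx', inv_smul_smul, smul_inv_smul]
  refine ⟨u⁻¹, V.inv_mem huV, ?_⟩
  -- `γ' = u⁻¹ g p⁻¹`, so `γ' Π_b γ'⁻¹ = u⁻¹ g Π_b g⁻¹ u`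
  have hγ' : γ' = u⁻¹ * g * (𝒢.piVToPi v F p)⁻¹ := by rw [hu]; group
  have hpPb : (𝒢.piVToPi v F p)⁻¹ ∈ Pb := Pb.inv_mem (Subgroup.mem_map_of_mem _ hp)
  have hconj : ConjAct.toConjAct γ' • Pb = ConjAct.toConjAct (u⁻¹ * g) • Pb := by
    rw [hγ', map_mul, mul_smul,
      Subgroup.conjAct_pointwise_smul_eq_self (Subgroup.le_normalizer hpPb)]
  rw [hconj, map_mul, mul_smul, Subgroup.smul_inf,
    Subgroup.Normal.conjAct (inferInstance : V.Normal) (ConjAct.toConjAct u⁻¹)]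

omit [FiberFunctor F] in
/-- **The level edges through `g⁻¹ · x₀` and `x₀` coincide iff `g ∈ V · Π_b`** — for an object all of
whose points have stabiliser `V`; this is the conclusion `g ∈ V · Π_b` of abc-iut-L3-t12's
`LevelEdgeSeparation` read on the level edges. [cite: MochizukiSemiAnbd2006, Rem. 2.2.1 p.24] -/
theorem eComp_eq_iff_mem_mul_of_inv {V : Subgroup (𝒢.Pi v F)}
    (hV : ∀ x : (𝒢.ρ v ⋙ F).obj X, MulAction.stabilizer (𝒢.Pi v F) x = V) {x₀ : (𝒢.ρ v ⋙ F).obj X}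
    (g : 𝒢.Pi v F) {Q₁ Q : π₀Obj (X.T (𝒢.graph.edgeOf b))}
    (hQ₁ : Fe.map (X.ψ b v h).hom (α.inv.app (X.S v) x₀) ∈ Set.range (Fe.map Q₁.1.arrow))
    (hQ : Fe.map (X.ψ b v h).hom (α.inv.app (X.S v) (g⁻¹ • x₀)) ∈ Set.range (Fe.map Q.1.arrow)) :
    Q = Q₁ ↔ g ∈ (V : Set (𝒢.Pi v F)) *
      (((𝒢.branchSubgroup F b h Fe α).map (𝒢.piVToPi v F) : Subgroup (𝒢.Pi v F)) :
        Set (𝒢.Pi v F)) := by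
  rw [eComp_eq_iff_mem_map_mul_stabilizer X F b h Fe α g⁻¹ hQ₁ hQ, hV x₀, ← Set.inv_mem_inv,
    mul_inv_rev, inv_coe_set, inv_coe_set, inv_inv]

/-! ### The frame `F := b^* ⋙ F_e`, `α := refl` of `LevelEdgeSeparation` -/

omit [FiberFunctor Fe] in
/-- In the frame of `LevelEdgeSeparation` (basepoint of `𝒢_v` INDUCED from `F_e` along `b`, transport
the identity), the branch subgroup pushed into `Π_𝒢` is literally the range of `Π_b → Π_𝒢`.
[cite: MochizukiSemiAnbd2006, Def. 2.1 p.23] -/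
theorem map_piVToPi_branchSubgroup_refl :
    (𝒢.branchSubgroup ((𝒢.pull b v h).pullback ⋙ Fe) b h Fe (Iso.refl _)).map
        (𝒢.piVToPi v ((𝒢.pull b v h).pullback ⋙ Fe)) =
      (𝒢.piBToPi b v h Fe).range := by
  rw [branchSubgroup_eq_map_range, Subgroup.map_map, ← MonoidHom.range_comp]
  congr 1

/-! ### The group-theoretic core of the level-wise edge separation (v2, appended) -/

omit [FiberFunctor F] in
/-- **Distinct level edges from `g ∉ V · Π_b`.**  If every point of the fibre of `X` has stabiliser
`V` and `g ∉ V · Π_b`, then the level edges of `𝒢_X` through `x₀` (`Q₁ ∋ y x₀`) and through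
`g⁻¹ · x₀` (`Q ∋ y(g⁻¹ · x₀)`) are distinct — the two edges separated one level up in the proof of
Remark 2.10.1 (cf. Cor. 2.7 (i), p. 30: "`g · ℋ″ ≠ ℋ″`"). [cite: MochizukiSemiAnbd2006, Rem. 2.10.1 p.32] -/
theorem levelEdge_ne_of_not_mem_mul {V : Subgroup (𝒢.Pi v F)}
    (hV : ∀ x : (𝒢.ρ v ⋙ F).obj X, MulAction.stabilizer (𝒢.Pi v F) x = V) {x₀ : (𝒢.ρ v ⋙ F).obj X}
    {g : 𝒢.Pi v F}
    (hg : g ∉ (V : Set (𝒢.Pi v F)) *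
      (((𝒢.branchSubgroup F b h Fe α).map (𝒢.piVToPi v F) : Subgroup (𝒢.Pi v F)) :
        Set (𝒢.Pi v F)))
    {Q₁ Q : π₀Obj (X.T (𝒢.graph.edgeOf b))}
    (hQ₁ : Fe.map (X.ψ b v h).hom (α.inv.app (X.S v) x₀) ∈ Set.range (Fe.map Q₁.1.arrow))
    (hQ : Fe.map (X.ψ b v h).hom (α.inv.app (X.S v) (g⁻¹ • x₀)) ∈ Set.range (Fe.map Q.1.arrow)) :
    Q ≠ Q₁ := fun hQQ₁ =>
  hg ((eComp_eq_iff_mem_mul_of_inv X F b h Fe α hV g hQ₁ hQ).mp hQQ₁)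

omit [FiberFunctor F] in
/-- **The group-theoretic core of the level-wise edge separation.**  Let every point of the fibre of
`X` have stabiliser `V`, let `Q₁ ∋ y x₀` and `Q ∋ y(g⁻¹ · x₀)` be the level edges through `x₀` and
`g⁻¹ · x₀`, and let `T₁, T_g ⊆ Π` be subgroups of the shape delivered by the dictionary:
`T₁ = V ⊓ γ₁Π_bγ₁⁻¹` with `Q₁ ∋ y(γ₁⁻¹ · x₀)` and `T_g = V ⊓ γΠ_bγ⁻¹` with `Q ∋ y(γ⁻¹ · x₀)` (the images
in `Π` of the branch groups of the two level edges).  If `U ⊆ Π` is normalised by `V` and `T_g ≤ U`,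
then `V ⊓ Π_b ≤ gΠ_bg⁻¹` implies `T₁ ≤ U`.  (Proof: `T_g = s(V ⊓ gΠ_bg⁻¹)s⁻¹`, `T₁ = s₁(V ⊓ Π_b)s₁⁻¹`
with `s, s₁ ∈ V` by `exists_mem_inf_conj_eq`; so `V ⊓ Π_b ≤ V ⊓ gΠ_bg⁻¹ = s⁻¹T_gs ≤ U` and
`T₁ ≤ s₁Us₁⁻¹ = U`.) [cite: MochizukiSemiAnbd2006, Rem. 2.10.1 p.32] -/
theorem le_of_levelEdgeGroups {V : Subgroup (𝒢.Pi v F)}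
    (hV : ∀ x : (𝒢.ρ v ⋙ F).obj X, MulAction.stabilizer (𝒢.Pi v F) x = V) {x₀ : (𝒢.ρ v ⋙ F).obj X}
    {g γ₁ γ : 𝒢.Pi v F} {Q₁ Q : π₀Obj (X.T (𝒢.graph.edgeOf b))}
    (hQ₁ : Fe.map (X.ψ b v h).hom (α.inv.app (X.S v) x₀) ∈ Set.range (Fe.map Q₁.1.arrow))
    (hQ : Fe.map (X.ψ b v h).hom (α.inv.app (X.S v) (g⁻¹ • x₀)) ∈ Set.range (Fe.map Q.1.arrow))
    (hγ₁ : Fe.map (X.ψ b v h).hom (α.inv.app (X.S v) (γ₁⁻¹ • x₀)) ∈ Set.range (Fe.map Q₁.1.arrow))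
    (hγ : Fe.map (X.ψ b v h).hom (α.inv.app (X.S v) (γ⁻¹ • x₀)) ∈ Set.range (Fe.map Q.1.arrow))
    {T₁ Tg U : Subgroup (𝒢.Pi v F)}
    (hT₁ : T₁ = V ⊓ ConjAct.toConjAct γ₁ • (𝒢.branchSubgroup F b h Fe α).map (𝒢.piVToPi v F))
    (hTg : Tg = V ⊓ ConjAct.toConjAct γ • (𝒢.branchSubgroup F b h Fe α).map (𝒢.piVToPi v F))
    (hUV : ∀ s ∈ V, ConjAct.toConjAct s • U = U) (hTgU : Tg ≤ U)
    (H : V ⊓ (𝒢.branchSubgroup F b h Fe α).map (𝒢.piVToPi v F) ≤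
      ConjAct.toConjAct g • (𝒢.branchSubgroup F b h Fe α).map (𝒢.piVToPi v F)) :
    T₁ ≤ U := by
  set Pb := (𝒢.branchSubgroup F b h Fe α).map (𝒢.piVToPi v F) with hPb
  -- `x₀ = 1⁻¹ • x₀` lies on `Q₁`
  have hQ₁' : Fe.map (X.ψ b v h).hom (α.inv.app (X.S v) ((1 : 𝒢.Pi v F)⁻¹ • x₀)) ∈
      Set.range (Fe.map Q₁.1.arrow) := by
    rw [inv_one, one_smul]; exact hQ₁
  -- the two groups up to `V`-conjugacy
  obtain ⟨s₁, hs₁, hT₁'⟩ := exists_mem_inf_conj_eq X F b h Fe α hV γ₁ 1 hγ₁ hQ₁'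
  obtain ⟨s, hs, hTg'⟩ := exists_mem_inf_conj_eq X F b h Fe α hV γ g hγ hQ
  rw [map_one, one_smul] at hT₁'
  rw [← hPb] at hT₁' hTg'
  -- `V ⊓ gΠ_bg⁻¹ = s⁻¹ T_g s ≤ U`
  have h1 : V ⊓ ConjAct.toConjAct g • Pb ≤ U := by
    have : V ⊓ ConjAct.toConjAct g • Pb = ConjAct.toConjAct s⁻¹ • Tg := by
      rw [hTg, hTg', smul_smul, ← map_mul, inv_mul_cancel, map_one, one_smul]
    rw [this, ← hUV s⁻¹ (V.inv_mem hs)]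
    exact Subgroup.pointwise_smul_le_pointwise_smul_iff.mpr hTgU
  -- `V ⊓ Π_b ≤ V ⊓ gΠ_bg⁻¹ ≤ U`
  have h2 : V ⊓ Pb ≤ U := le_trans (le_inf inf_le_left H) h1
  -- `T₁ = s₁ (V ⊓ Π_b) s₁⁻¹ ≤ s₁ U s₁⁻¹ = U`
  rw [hT₁, hT₁', ← hUV s₁ hs₁]
  exact Subgroup.pointwise_smul_le_pointwise_smul_iff.mpr h2

end SemiGraphOfAnabelioids

end Literature.AnabelianGeometry.SemiGraphs
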